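import Literature.AnabelianGeometry.EtaleTheta.XuuCocycleOfProp15
import Literature.AnabelianGeometry.EtaleTheta.Discharge.Sec1DeckSign
import HarnessLib

/-!
# [EtTh] Prop. 2.2 (ii) / Def. 2.7 in the §1 model: the choice `X̲̲` — guard-free variants over
# `Sec1DeckSign` (the `μ₂`-half from Prop. 1.5 (iii) by seat abc-iut-L2-t1)

Mochizuki, *The étale theta function and its Frobenioid-theoretic manifestations*, Publ. RIMS **45**
(2009): Prop. 1.5 (ii), (iii) (PRIMS PDF p. 23), Def. 2.7 (p. 41: "`Π^tp_X̲/Π^tp_Ÿ ≅ (l·Z) × μ₂`", "it is a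
tautology that, upon restriction to the covering `Ÿ̲̲ → Ÿ` …, the class `η̈^Θ` determines a class
`η̲̈^Θ ∈ H¹(Π^tp_Ÿ̲̲, l·Δ_Θ)`") [cite: MochizukiEtTh2009, Def 2.7 p.41].

Cell abc-iut, layer L2, item N3 (seat abc-iut-L2-t7), row "x1 ⋈ §1 JUNCTION" (L2-lead 2026-08-26), variants
over seat abc-iut-L2-t1's `Sec1DeckSign`. PROOF-ONLY (0 definitions). The capstone
`XuuCocycleOfSectionOneFacts.nonempty_doubleUnderline_of_sectionOneFacts` (X̲̲ exists from the named §1 facts,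
with the vacuity guard `IsEtThOrigin` and `Prop15ii`) carries a private copy of the sign-clause argument;
HERE the sign clause "every `ε ∈ Π^tp_Y` moves `η̈^Θ` by a class of square `1`" is taken from the theorem of
record, `Sec1DeckSign.exists_sq_eq_one_and_conj_eq` (Prop. 1.5 (iii) at `a = 0` plus the involution
`ε² ∈ Π^tp_Ÿ`, by seat abc-iut-L2-t1), giving the public generator lemma
`mem_invModPowStabilizer_of_prop15iii` and the GUARD-FREE variants for consumers that hold the
`l·Z`-translate clause directly (`nonempty_doubleUnderline_of_translate_class`: inputs `Compat`, `K = K̈`,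
`Prop15iii`, `CyclotomeMod 1 l`, `l` odd, one class-level statement) or a Kummer-function presentation of
`η̈^Θ` (`invariant_modPow_of_sectionOne`, `nonempty_doubleUnderline_of_sectionOne`: `IsThetaKummer E T` and
Prop. 1.4 (ii) at `a = l` as `t•Θ̈ = g^l·Θ̈`). No new `Prop` fact; nothing of [EtTh] is asserted; typed ≠
endorsed; no side is taken on any disputed claim.
-/

noncomputable section

namespace Literature.AnabelianGeometry.EtaleTheta

open Literature.AnabelianGeometry.SemiGraphs
open scoped IsMulCommutative

namespace ThetaSetting

namespace EtaleThetaData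

variable {p : ℕ} [Fact p.Prime] {D : ThetaSetting p} {E : D.EtaleThetaData}

/-- **The `μ₂`-generator from the §1 facts alone**: under `K = K̈`, every `ε ∈ Π^tp_Y` stabilises every
theta class `x ∈ O^×_K̈ · η̈^Θ` modulo `n`-th powers for `n` ODD — by seat abc-iut-L2-t1's
`exists_sq_eq_one_and_conj_eq` (Prop. 1.5 (iii) at `a = 0` + the involution `ε² ∈ Π^tp_Ÿ`:
`ε·x = x·κ₁`, `κ₁² = 1`, so `κ₁ = κ₁^n`). [cite: MochizukiEtTh2009, Prop 1.5 (iii) p.23] -/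
theorem mem_invModPowStabilizer_of_prop15iii (hC : D.Compat) (hS : D.Sec2Hyps) [D.GtpYdd.Normal]
    (h15 : Prop15iii E hC) {n : ℕ} (hn : Odd n) {x : D.H1 D.GtpYdd} (hx : x ∈ E.thetaClasses)
    {ε : D.PiTemp} (hε : ε ∈ D.GtpY) : ε ∈ invModPowStabilizer x n := by
  obtain ⟨κ, hκ, h⟩ := E.exists_sq_eq_one_and_conj_eq hC hS h15 hε hx
  exact mem_invModPowStabilizer_of_sq_eq_one x hn hκ h

/-- **`X̲̲` exists from the §1 facts plus ONE class-level statement** — for some lift `t` of `l ∈ Z`,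
`t·η̈^Θ ≡ η̈^Θ` modulo `l`-th powers in `H¹(Π^tp_Ÿ, Δ_Θ)` (kept for consumers holding the translate clause
directly; `XuuCocycleOfProp15.exists_translate_class_of_prop15` derives it under the guard). Other
inputs: `Compat`, `K = K̈`,
`Prop15iii`, `CyclotomeMod 1 l`, `l` odd. [cite: MochizukiEtTh2009, Def 2.7 p.41] -/
theorem nonempty_doubleUnderline_of_translate_class (hC : D.Compat) (hS : D.Sec2Hyps)
    (h15 : Prop15iii E hC) {l : ℕ+} (μ : D.CyclotomeMod 1 l) (hl : Odd (l : ℕ)) {t : D.PiTemp}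
    (htZ : D.toZ t = Multiplicative.ofAdd ((l : ℕ) : ℤ))
    (ht : ∃ κ : D.H1 D.GtpYdd,
      haveI := hC.GtpYdd_normal
      ContH1.conj D.toTheta D.DeltaTheta t E.etaDd = E.etaDd * κ ^ (l : ℕ)) :
    Nonempty (E.DoubleUnderline l) :=
  haveI := hC.GtpYdd_normal
  nonempty_doubleUnderline_of_classLevel hC hS h15 μ hl
    (fun _ hε => E.exists_sq_eq_one_and_conj_eq hC hS h15 hε E.etaDd_mem_thetaClasses) htZ ht

variable (T : D.ThetaKummerInput)

/-- **Invariance of `η̈^Θ` modulo `l`-th powers under `Π^tp_X̲`, Kummer-presentation form**: from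
`Prop15iii` (the `μ₂`-half), `Prop15ii` (inertness of the unit factor), `K = K̈`, seat abc-iut-L2-t12's
relation `IsThetaKummer E T` ("`η̈^Θ ∈ O^×_K̈ · κ(Θ̈)`"), and Prop. 1.4 (ii) for ONE lift `t` of `l ∈ Z`
in the form `t•Θ̈ = g^l·Θ̈` (`toZ t = l`). [cite: MochizukiEtTh2009, Def 2.7 p.41] -/
theorem invariant_modPow_of_sectionOne (hC : D.Compat) (hS : D.Sec2Hyps) [D.GtpYdd.Normal]
    (h15 : Prop15iii E hC) (h15ii : Prop15ii E.toKummerData hC) (hηT : E.IsThetaKummer T)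
    {l : ℕ} (hl : Odd l) {g : T.Fn} (hg : g ∈ MulAction.fixedPoints D.GtpYdd T.Fn) (x : RootSystem g)
    {t : D.PiTemp} (htZ : D.toZ t = Multiplicative.ofAdd (l : ℤ)) (htrans : t • T.theta = g ^ l * T.theta) :
    ∀ σ ∈ D.GtpXu l, ∃ κ : D.H1 D.GtpYdd,
      ContH1.conj D.toTheta D.DeltaTheta σ E.etaDd = E.etaDd * κ ^ l := by
  obtain ⟨t₁, ht₁, ht₁N⟩ := D.exists_mem_GtpY_not_mem_GtpYdd hS
  have h₁ : t₁ ∈ invModPowStabilizer E.etaDd l :=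
    mem_invModPowStabilizer_of_prop15iii hC hS h15 hl E.etaDd_mem_thetaClasses ht₁
  exact invariant_modPow_of_generators hS E.etaDd l hl.pos.ne' ht₁ ht₁N
    ((mem_invModPowStabilizer_iff E.etaDd l t₁).mp h₁) (mem_GtpXu_of_toZ_eq htZ)
    (toZDivL_eq_of_toZ_eq hl.pos.ne' htZ)
    (exists_conj_etaDd_eq_mul_pow_of_isThetaKummer T hC hS h15ii hηT hg x l htrans)

/-- **`X̲̲` exists — junction over a Kummer-function presentation** (kept for consumers carrying those
binders): `Compat`, `K = K̈`, `Prop15iii`, `Prop15ii`, `CyclotomeMod 1 l`, `l` odd, `IsThetaKummer E T`,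
and Prop. 1.4 (ii) at `a = l` on `Θ̈` (`t•Θ̈ = g^l·Θ̈`, `toZ t = l`; print: `g = −q̈^{−l}·Ü^{∓2}`).
[cite: MochizukiEtTh2009, Def 2.7 p.41] -/
theorem nonempty_doubleUnderline_of_sectionOne (hC : D.Compat) (hS : D.Sec2Hyps)
    (h15 : Prop15iii E hC) (h15ii : Prop15ii E.toKummerData hC) {l : ℕ+} (μ : D.CyclotomeMod 1 l)
    (hl : Odd (l : ℕ)) (hηT : E.IsThetaKummer T)
    {g : T.Fn} (hg : g ∈ MulAction.fixedPoints D.GtpYdd T.Fn) (x : RootSystem g)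
    {t : D.PiTemp} (htZ : D.toZ t = Multiplicative.ofAdd ((l : ℕ) : ℤ))
    (htrans : t • T.theta = g ^ (l : ℕ) * T.theta) :
    Nonempty (E.DoubleUnderline l) :=
  haveI := hC.GtpYdd_normal
  nonempty_doubleUnderline_of_isThetaKummer T hC hS h15 h15ii μ hl hηT
    (fun _ hε => E.exists_sq_eq_one_and_conj_eq hC hS h15 hε E.etaDd_mem_thetaClasses) hg x htZ htrans

end EtaleThetaData

end ThetaSetting

end Literature.AnabelianGeometry.EtaleTheta

end
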